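import Literature.Computability.AlgebraicComplexity.AndrewsForbes2022Lemma66AllFields
import Literature.Computability.AlgebraicComplexity.ArithCircuitDegreeBound
import Literature.Computability.AlgebraicComplexity.DeterminantalIdealSFTAllFields

/-!
# Andrews–Forbes 2022, Lemma 6.7 (low-rank matrices hit the closure of small low-depth circuits) — the discharge

The named fact `AndrewsForbes2022_lemma_6_7` (`AndrewsForbes2022Applications.lean`; AF22 p0033:L92):
there is a universal `c > 0` such that for every `Δ ≥ 1` there is `s₀` with: for every field `F` with
`char F = 0 ∨ char F > s^Δ`, every `s ≥ s₀` and every `r ≥ 2^{(log₂ s)^{1 - exp(-cΔ)}}`, the matrix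
generator `𝒢_{ν,ν,r-1}(Y,Z) = YZ` (Construction 2.8) is a hitting set generator for the closure of
`ν²`-variate circuits of wire size `s` and product-depth `Δ`.

The printed proof (p0034:L3–L12), followed verbatim:
* a polynomial in the closure of size-`s` product-depth-`Δ` circuits has degree `≤ s^Δ`
  (`ArithCircuit.totalDegree_eval_le_edgeSize_pow` for the approximating circuit over `F((ε))`, and
  `totalDegree_le_of_polyOrdGE_one_sub`: `deg f ≤ deg h` when `h = f + O(ε)`), so the hypothesis
  `char F > s^Δ` gives `char F > deg f`;
* if `f(𝒢_{ν,ν,r-1}(Y,Z)) = 0` then `f ∈ I^det_{ν,ν,r}` (Lemma 2.10, the tree's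
  `AndrewsForbes2022_lemma_2_10_allFields`, every field);
* Lemma 6.6 (`AndrewsForbes2022_lemma_6_6_holds`): `s ≥ r^{(log r)^{exp(-c₆Δ)}}`, contradicting
  `r ≥ 2^{(log₂ s)^{1 - exp(-cΔ)}}` once `c = c₆ + log 4` (so `exp(-cΔ) ≤ exp(-c₆Δ)/4`) and
  `s ≥ s₀(Δ)` (`BorderLST.lemma_6_7_arith`: `(log r)^{1+a} ≥ (log 2)^{1+a}(log₂ s)^{(1-b)(1+a)} >`
  `log s`).

Result: `AndrewsForbes2022_lemma_6_7_holds : AndrewsForbes2022_lemma_6_7` — **the named fact, PROVED**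
(every field, as printed).  Theorem-only; no new definitions or named facts (D-0026); net debt `−1`.
Honest framing: a hitting set for the closure of constant-depth circuits from the printed lower bound;
VP ≠ VNP is NOT touched.

## References
* [AndrewsForbes2022] R. Andrews, M. A. Forbes, *Ideals, determinants, and straightening: proving and
  using lower bounds for polynomial ideals*, STOC 2022, arXiv:2112.00792 — Lemma 6.7 and its proof
  (p0033:L92–p0034:L12), Lemma 2.10 (p0013:L71), Lemma 6.6 (p0033:L33).
-/

noncomputable section

namespace Literature.Computability.AlgebraicComplexity

open MvPolynomial Real Filter Topology

namespace BorderLST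

/-- The parameter regime of the proof of Lemma 6.7 (thresholds in `s`, chosen after `Δ`):
eventually in `s`, `s ≥ 2`, `2^{(log₂ s)^{1-b}} ≥ r₀` and `(log 2)^a (log₂ s)^{e} ≥ 2` (`e > 0`,
`1 - b > 0`). [cite: AndrewsForbes2022, Lemma 6.7 (proof)] -/
theorem lemma_6_7_eventually (r₀ : ℕ) {a b e : ℝ} (hb1 : b < 1) (he : 0 < e) :
    ∃ s₀ : ℕ, ∀ s : ℕ, s₀ ≤ s →
      2 ≤ s ∧ (r₀ : ℝ) ≤ Real.exp (Real.log 2 * (Real.logb 2 s) ^ (1 - b)) ∧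
        2 ≤ (Real.log 2) ^ a * (Real.logb 2 s) ^ e := by
  have hlog2 : 0 < Real.log 2 := Real.log_pos one_lt_two
  have hu : Tendsto (fun s : ℕ => Real.logb 2 s) atTop atTop := by
    have : Tendsto (fun s : ℕ => Real.log s / Real.log 2) atTop atTop :=
      (Real.tendsto_log_atTop.comp tendsto_natCast_atTop_atTop).atTop_div_const hlog2
    refine this.congr fun s => ?_
    rw [Real.log_div_log]
  have h2 : Tendsto (fun s : ℕ => Real.exp (Real.log 2 * (Real.logb 2 s) ^ (1 - b))) atTop atTop :=
    Real.tendsto_exp_atTop.comp (((tendsto_rpow_atTop (by linarith)).comp hu).const_mul_atTop hlog2)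
  have h3 : Tendsto (fun s : ℕ => (Real.log 2) ^ a * (Real.logb 2 s) ^ e) atTop atTop :=
    ((tendsto_rpow_atTop he).comp hu).const_mul_atTop (Real.rpow_pos_of_pos hlog2 a)
  obtain ⟨s₀, hs₀⟩ := Filter.eventually_atTop.1 ((Filter.eventually_ge_atTop 2).and
    ((h2.eventually_ge_atTop (r₀ : ℝ)).and (h3.eventually_ge_atTop 2)))
  exact ⟨s₀, fun s hs => hs₀ s hs⟩

/-- The arithmetic of the proof of Lemma 6.7 (p0034:L8–L12): with `u = log₂ s ≥ 1`,
`r ≥ 2^{u^{1-b}}` and `(log 2)^a u^{(1-b)(1+a)-1} ≥ 2`, the Lemma 6.6 bound `r^{(log r)^a}` exceeds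
`s`. [cite: AndrewsForbes2022, Lemma 6.7 (proof)] -/
theorem lemma_6_7_arith {a b : ℝ} (ha : 0 < a) (hb1 : b < 1) {s r : ℕ} (hs : 2 ≤ s)
    (hr : Real.exp (Real.log 2 * (Real.logb 2 s) ^ (1 - b)) ≤ r)
    (hE : 2 ≤ (Real.log 2) ^ a * (Real.logb 2 s) ^ ((1 - b) * (1 + a) - 1)) :
    (s : ℝ) < (r : ℝ) ^ ((Real.log r) ^ a) := by
  have hlog2 : 0 < Real.log 2 := Real.log_pos one_lt_two
  obtain ⟨u, hu⟩ : ∃ u : ℝ, u = Real.logb 2 s := ⟨_, rfl⟩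
  rw [← hu] at hr hE
  have hsR : (2 : ℝ) ≤ s := by exact_mod_cast hs
  have hs0 : (0 : ℝ) < s := by linarith
  have hu1 : 1 ≤ u := by
    rw [hu, ← Real.log_div_log, le_div_iff₀ hlog2, one_mul]
    exact Real.log_le_log two_pos hsR
  have hu0 : 0 < u := by linarith
  have hlogs : Real.log s = u * Real.log 2 := by
    rw [hu, ← Real.log_div_log, div_mul_cancel₀ _ hlog2.ne']
  -- `log r ≥ u^{1-b} log 2 > 0`
  have hr0 : (0 : ℝ) < r := lt_of_lt_of_le (Real.exp_pos _) hr
  have hlogr : Real.log 2 * u ^ (1 - b) ≤ Real.log r := by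
    have := Real.log_le_log (Real.exp_pos _) hr
    rwa [Real.log_exp] at this
  have hub : 1 ≤ u ^ (1 - b) := Real.one_le_rpow hu1 (by linarith)
  have hlogr0 : 0 < Real.log r := lt_of_lt_of_le (by nlinarith) hlogr
  -- `r^{(log r)^a} = exp ((log r)^{1+a})`
  have hpow : (r : ℝ) ^ ((Real.log r) ^ a) = Real.exp ((Real.log r) ^ (1 + a)) := by
    rw [Real.rpow_def_of_pos hr0, add_comm, Real.rpow_add_one hlogr0.ne', mul_comm]
  rw [hpow, ← Real.exp_log hs0, Real.exp_lt_exp, hlogs]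
  -- `(log r)^{1+a} ≥ (log 2 · u^{1-b})^{1+a} = (log 2)^{1+a} u^{(1-b)(1+a)}`
  have h1 : (Real.log 2 * u ^ (1 - b)) ^ (1 + a) ≤ (Real.log r) ^ (1 + a) :=
    Real.rpow_le_rpow (by positivity) hlogr (by linarith)
  refine lt_of_lt_of_le ?_ h1
  rw [Real.mul_rpow hlog2.le (by positivity), ← Real.rpow_mul hu0.le]
  have h2 : (Real.log 2) ^ (1 + a) = Real.log 2 * (Real.log 2) ^ a := by
    rw [Real.rpow_add hlog2, Real.rpow_one]
  have h3 : u ^ ((1 - b) * (1 + a)) = u * u ^ ((1 - b) * (1 + a) - 1) := by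
    conv_lhs => rw [show (1 - b) * (1 + a) = 1 + ((1 - b) * (1 + a) - 1) by ring]
    rw [Real.rpow_add hu0, Real.rpow_one]
  rw [h2, h3]
  have h4 : (0 : ℝ) < u * Real.log 2 := mul_pos hu0 hlog2
  nlinarith

/-- `exp(-(c₆ + log 4) Δ) ≤ exp(-c₆ Δ)/4` for `Δ ≥ 1`. [cite: AndrewsForbes2022, Lemma 6.7 (proof)] -/
theorem exp_neg_add_log_four_le {c₆ : ℝ} {Δ : ℕ} (hΔ : 1 ≤ Δ) :
    Real.exp (-((c₆ + Real.log 4) * Δ)) ≤ Real.exp (-(c₆ * Δ)) / 4 := by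
  have h4 : Real.exp (-(Real.log 4 * Δ)) = ((4 : ℝ) ^ Δ)⁻¹ := by
    rw [Real.exp_neg, mul_comm, Real.exp_nat_mul, Real.exp_log (by norm_num)]
  rw [show -((c₆ + Real.log 4) * Δ) = -(c₆ * Δ) + -(Real.log 4 * Δ) by ring, Real.exp_add, h4,
    div_eq_mul_inv]
  refine mul_le_mul_of_nonneg_left (inv_anti₀ (by norm_num) ?_) (Real.exp_pos _).le
  calc (4 : ℝ) = 4 ^ 1 := (pow_one _).symm
    _ ≤ 4 ^ Δ := pow_le_pow_right₀ (by norm_num) hΔ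

end BorderLST

open scoped RatFunc LaurentSeries in
/-- **Discharge of `AndrewsForbes2022_lemma_6_7`** (AF22 Lemma 6.7, p0033:L92 — low-rank matrices
hit the closure of small low-depth circuits), following the printed proof (p0034:L3–L12): let
`f ≠ 0` lie in the closure of wire-size-`s` product-depth-`Δ` circuits and suppose
`f(𝒢_{ν,ν,r-1}(Y,Z)) = 0`.  Then `deg f ≤ s^Δ` (the approximating circuit has all fan-ins `≤ s`:
`ArithCircuit.totalDegree_eval_le_edgeSize_pow`, and `deg f ≤ deg h` for `h = f + O(ε)`:
`totalDegree_le_of_polyOrdGE_one_sub`), so `char F = 0 ∨ char F > deg f`; by Lemma 2.10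
(`AndrewsForbes2022_lemma_2_10_allFields`, every field, no restriction on `r`) `f ∈ I^det_{ν,ν,r}`;
by Lemma 6.6 (`AndrewsForbes2022_lemma_6_6_holds`) `s ≥ r^{(log r)^{exp(-c₆Δ)}}`, which
contradicts `r ≥ 2^{(log₂ s)^{1 - exp(-cΔ)}}` for `c = c₆ + log 4` and `s ≥ s₀(Δ)`
(`BorderLST.lemma_6_7_arith`).  [cite: AndrewsForbes2022, Lemma 6.7] -/
theorem AndrewsForbes2022_lemma_6_7_holds : AndrewsForbes2022_lemma_6_7 := by
  classical
  obtain ⟨c₆, hc₆, H66⟩ := AndrewsForbes2022_lemma_6_6_holds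
  refine ⟨c₆ + Real.log 4, add_pos hc₆ (Real.log_pos (by norm_num)), fun Δ hΔ => ?_⟩
  obtain ⟨r₀, hr₀⟩ := H66 Δ hΔ
  obtain ⟨a, ha⟩ : ∃ a : ℝ, a = Real.exp (-(c₆ * Δ)) := ⟨_, rfl⟩
  obtain ⟨b, hb⟩ : ∃ b : ℝ, b = Real.exp (-((c₆ + Real.log 4) * Δ)) := ⟨_, rfl⟩
  have ha0 : 0 < a := by rw [ha]; exact Real.exp_pos _
  have ha1 : a ≤ 1 := by
    rw [ha, Real.exp_le_one_iff]
    have : (0 : ℝ) ≤ c₆ * Δ := by positivity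
    linarith
  have hb0 : 0 < b := by rw [hb]; exact Real.exp_pos _
  have hba : b ≤ a / 4 := by rw [ha, hb]; exact BorderLST.exp_neg_add_log_four_le hΔ
  have hb1 : b < 1 := by linarith
  have he : 0 < (1 - b) * (1 + a) - 1 := by nlinarith
  obtain ⟨s₀, hs₀⟩ := BorderLST.lemma_6_7_eventually r₀ (a := a) hb1 he
  refine ⟨s₀, fun F _ ν s hs hchar r hr => ?_⟩
  obtain ⟨hs2, hr₀s, hE⟩ := hs₀ s hs
  rw [← hb] at hr
  intro f hf hf0 hG
  -- `r ≥ 1` and `r ≥ r₀`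
  have hr' : Real.exp (Real.log 2 * (Real.logb 2 s) ^ (1 - b)) ≤ r := by
    rw [← Real.rpow_def_of_pos two_pos]; exact hr
  have hrR : (r₀ : ℝ) ≤ r := hr₀s.trans hr'
  have hr₀r : r₀ ≤ r := by exact_mod_cast hrR
  have hr1 : 1 ≤ r := by
    have : (0 : ℝ) < r := lt_of_lt_of_le (Real.exp_pos _) hr'
    exact_mod_cast (show (0 : ℝ) < r from this)
  -- Lemma 2.10: `f ∈ I^det_{ν,ν,r}`
  have hfI : f ∈ detIdeal F ν ν r := (AndrewsForbes2022_lemma_2_10_allFields F ν ν r hr1 f).1 hG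
  -- `deg f ≤ s^Δ`
  obtain ⟨h, hh, hord⟩ := hf
  have hdeg : f.totalDegree ≤ s ^ Δ := by
    refine (totalDegree_le_of_polyOrdGE_one_sub hord).trans ?_
    obtain ⟨P, hP, hPΔ, hPs⟩ := hh
    rw [← hP]
    exact P.totalDegree_eval_le_edgeSize_pow (by omega) hPs hPΔ
  have hchar' : ringChar F = 0 ∨ f.totalDegree < ringChar F :=
    hchar.imp id fun hp => lt_of_le_of_lt hdeg hp
  -- Lemma 6.6
  have hbound := hr₀ F ν ν r hr₀r f hfI hf0 hchar' s ⟨h, hh, hord⟩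
  rw [← ha] at hbound
  exact absurd hbound (not_le.2 (BorderLST.lemma_6_7_arith ha0 hb1 hs2 hr' hE))

end Literature.Computability.AlgebraicComplexity
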